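import Summits.QuantumFields.GaugeBoot.WordUpdate
import Summits.QuantumFields.GaugeBoot.WordDerivative
import Summits.QuantumFields.GaugeBoot.SU2OneLinkMean
import Literature.Analysis.FunctionSpaces.BesselIDerivative
import HarnessLib

/-!
# Gauge-boot: the Wilson action with one link replaced — staples, the quaternionic staple sum, and its size

Cell `ym-instrument` (HOME `run/shared/lean/pub/ym-instrument/`), crew (a), seat `ym-instrument-boot-lean-1`;
A-plan-11 «BESSEL CAP» typing, file 4/6 (the action side of the one-link heat-bath step).

HONEST FRAMING (page 1 of every file of this cell): algebra and point-set facts about the torus Wilson action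
`S(U) = ∑ₚ (N - Re tr ρ(U_p))` of the tree (`ConstructiveQFTWave0.wilsonAction`) on `(ℤ/L)^d`, `L ≥ 2`; no
expectation is computed and nothing is certified about any `(G, D, L, β)`; nothing summit-bearing.

## Content

* `boundaryWord p`, `plaqsReading e` (the plaquettes whose boundary word reads the edge `e`), `SharePlaquette e e'`;
  every plaquette reads every edge at most once when `L ≥ 2` (file `WordUpdate`), and at most `2(d-1)` plaquettes
  read a given edge (`card_plaqsReading_le`).
* `plaqStaple ρ? e p U` — the staple of `p` at `e` (file `WordUpdate`'s `Word.Split.staple`), not reading `e`, and not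
  reading any edge `e'` that shares no plaquette with `e`; **the action with the link `e` replaced**:
  `S(U[e ↦ g]) = farAction e U - ∑_{p reads e} Re tr ρ(g · plaqStaple e p U)` (`wilsonAction_update`), any group `G`
  and matrix representation `ρ` of a compact group.
* For `G = SU(2)` in the fundamental representation: the **quaternionic staple sum**
  `stapleSum e U = ∑_{p reads e} su2Quat (plaqStaple e p U) ∈ ℍ` with
  `∑_{p reads e} Re tr (g · plaqStaple) = Re tr (g · quatMatrix (stapleSum e U))` (`sum_re_trace_eq_stapleSum`),
  `‖stapleSum e U‖ ≤ 2(d-1)` (`norm_stapleSum_le`), its invariance under replacing `U_e` or any `U_{e'}` with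
  `¬ SharePlaquette e e'`, and its continuity in `U`; the weight factorisation
  `exp(-t S(U[e ↦ g])) = exp(-t·farAction e U) · exp(t Re tr(g · quatMatrix (stapleSum e U)))`
  (`exp_neg_mul_wilsonAction_update`) — Creutz's "the action depends on one link through `Re tr(U_e K_e)` with
  `K_e` the sum of the `2(d-1)` staples" (Phys. Rev. D 21 (1980) 2308, §III).
* Two facts about the one-link mean of file `SU2OneLinkMean` used downstream: `|linkMean B| ≤ 1` and continuity.
-/

noncomputable section

open MeasureTheory Complex
open Literature.MathematicalPhysics.QuantumFieldTheory
open Literature.MathematicalPhysics.QuantumLattice (quatMatrix quatToSU2 su2Quat quatMatrix_su2Quat norm_su2Quat)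
open Literature.Analysis.FunctionSpaces (besselI differentiable_besselI)

namespace Summit.QuantumFields.GaugeBoot

variable {d L : ℕ}

/-! ## Plaquette words, the plaquettes reading an edge, sharing a plaquette -/

/-- The boundary word `+eᵢ +eⱼ −eᵢ −eⱼ` of the plaquette `p = (y, i < j)`, read from its base point `p.1`
(tree `Word.plaquette`, `wordHolonomy_plaquette`). [folklore] -/
def boundaryWord (p : Plaquette d L) : Word d := Word.plaquette p.2.1.1 p.2.1.2

/-- The plaquette holonomy of the tree is the holonomy of the plaquette word. [folklore] -/
theorem plaquetteHolonomy_eq_wordHolonomy {G : Type*} [Group G] (U : GaugeConfig d L G) (p : Plaquette d L) :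
    plaquetteHolonomy U p.1 p.2.1.1 p.2.1.2 = wordHolonomy U p.1 (boundaryWord p) :=
  (wordHolonomy_plaquette U p.1 p.2.1.1 p.2.1.2).symm

/-- On a torus of side `L ≥ 2` every plaquette word reads every edge at most once. [folklore] -/
theorem count_edgesRead_boundaryWord_le_one (hL : 1 < L) (p : Plaquette d L) (e : Edge d L) :
    (Word.edgesRead p.1 (boundaryWord p)).count e ≤ 1 :=
  Word.count_edgesRead_plaquette_le_one hL p.1 (ne_of_lt p.2.2) e

/-- An edge READ by a plaquette word is read exactly once (`L ≥ 2`). [folklore] -/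
theorem count_edgesRead_boundaryWord_eq_one (hL : 1 < L) {p : Plaquette d L} {e : Edge d L}
    (h : e ∈ Word.edgesRead p.1 (boundaryWord p)) : (Word.edgesRead p.1 (boundaryWord p)).count e = 1 :=
  le_antisymm (count_edgesRead_boundaryWord_le_one hL p e) (List.count_pos_iff.2 h)

section Reading

variable [NeZero L]

/-- The plaquettes whose boundary word reads the edge `e`. [folklore] -/
def plaqsReading (e : Edge d L) : Finset (Plaquette d L) :=
  Finset.univ.filter fun p => e ∈ Word.edgesRead p.1 (boundaryWord p)

/-- Membership in `plaqsReading`. [folklore] -/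
@[simp] theorem mem_plaqsReading {e : Edge d L} {p : Plaquette d L} :
    p ∈ plaqsReading e ↔ e ∈ Word.edgesRead p.1 (boundaryWord p) := by
  simp [plaqsReading]

/-- Two edges SHARE A PLAQUETTE: some plaquette word reads both. [folklore] -/
def SharePlaquette (e e' : Edge d L) : Prop :=
  ∃ p : Plaquette d L, e ∈ Word.edgesRead p.1 (boundaryWord p) ∧ e' ∈ Word.edgesRead p.1 (boundaryWord p)

omit [NeZero L] in
/-- The plaquette with directions `{μ, ν}` (`μ ≠ ν`) based at `y`, as a term of the tree's `Plaquette d L`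
(junk: the given `p₀` when `μ = ν`). [folklore] -/
def mkPlaq (p₀ : Plaquette d L) (y : Site d L) (μ ν : Fin d) : Plaquette d L :=
  if h : μ < ν then (y, ⟨(μ, ν), h⟩) else if h' : ν < μ then (y, ⟨(ν, μ), h'⟩) else p₀

omit [NeZero L] in
/-- Every plaquette reading `e = (x, μ)` is `mkPlaq` of the base point `x` or `x - e_ν` and the directions `μ, ν`
for some `ν ≠ μ`. [folklore] -/
theorem exists_eq_mkPlaq_of_mem_edgesRead (p₀ : Plaquette d L) {e : Edge d L} {p : Plaquette d L}
    (h : e ∈ Word.edgesRead p.1 (boundaryWord p)) :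
    ∃ ν : Fin d, ν ≠ e.2 ∧ (p = mkPlaq p₀ e.1 e.2 ν ∨ p = mkPlaq p₀ (e.1 - Pi.single ν 1) e.2 ν) := by
  obtain ⟨y, ⟨⟨i, j⟩, hij⟩⟩ := p
  change e ∈ Word.edgesRead y (Word.plaquette i j) at h
  rw [Word.edgesRead_plaquette] at h
  simp only [List.mem_cons, List.not_mem_nil, or_false] at h
  have hji : ¬j < i := not_lt.2 (le_of_lt hij)
  have hsub : ∀ (z : Site d L) (k : Fin d), z.shift k - Pi.single k 1 = z := fun z k => by simp [Site.shift]
  rcases h with h | h | h | h <;> subst h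
  · exact ⟨j, ne_of_gt hij, Or.inl (by simp [mkPlaq, hij])⟩
  · exact ⟨i, ne_of_lt hij, Or.inr (by simp [mkPlaq, hij, hji, hsub])⟩
  · exact ⟨j, ne_of_gt hij, Or.inr (by simp [mkPlaq, hij, hsub])⟩
  · exact ⟨i, ne_of_lt hij, Or.inl (by simp [mkPlaq, hij, hji])⟩

/-- **At most `2(d-1)` plaquettes read a given edge** (for each direction `ν ≠ μ`, the plaquette in the `{μ,ν}`
plane above and below `e`). [folklore] -/
theorem card_plaqsReading_le (e : Edge d L) : (plaqsReading e).card ≤ 2 * (d - 1) := by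
  classical
  rcases (plaqsReading e).eq_empty_or_nonempty with h0 | ⟨p₀, -⟩
  · rw [h0]; simp
  · set D : Finset (Fin d × Bool) := (Finset.univ.erase e.2) ×ˢ Finset.univ with hD
    set f : Fin d × Bool → Plaquette d L := fun νb =>
      if νb.2 then mkPlaq p₀ e.1 e.2 νb.1 else mkPlaq p₀ (e.1 - Pi.single νb.1 1) e.2 νb.1 with hf
    have hsub : plaqsReading e ⊆ D.image f := by
      intro p hp
      rw [mem_plaqsReading] at hp
      obtain ⟨ν, hν, hp⟩ := exists_eq_mkPlaq_of_mem_edgesRead p₀ hp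
      rw [Finset.mem_image]
      rcases hp with hp | hp
      · exact ⟨(ν, true), by simp [hD, hν], by simp [hf, hp]⟩
      · exact ⟨(ν, false), by simp [hD, hν], by simp [hf, hp]⟩
    calc (plaqsReading e).card ≤ (D.image f).card := Finset.card_le_card hsub
      _ ≤ D.card := Finset.card_image_le
      _ = 2 * (d - 1) := by
        rw [hD, Finset.card_product, Finset.card_erase_of_mem (Finset.mem_univ _), Finset.card_univ,
          Fintype.card_fin, Finset.card_univ, Fintype.card_bool, mul_comm]

end Reading

/-! ## Staples and the action with one link replaced (any group) -/

section General

variable {G : Type*} [Group G]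

/-- The STAPLE of the plaquette `p` at the edge `e`: the group element `B A` / `(B A)⁻¹` of `Word.Split.staple` for the
(chosen) split of the plaquette word at `e`, so that `Re tr ρ(U_p[e ↦ g]) = Re tr ρ(g · staple)`; junk `1` when `p`
does not read `e` exactly once. [folklore] -/
def plaqStaple (e : Edge d L) (p : Plaquette d L) (U : GaugeConfig d L G) : G :=
  if h : (Word.edgesRead p.1 (boundaryWord p)).count e = 1 then (Word.split p.1 (boundaryWord p) e h).staple U else 1

/-- The staple at `e` does not read `e`. [folklore] -/
theorem plaqStaple_update_self (e : Edge d L) (p : Plaquette d L) (U : GaugeConfig d L G) (g : G) :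
    plaqStaple e p (Function.update U e g) = plaqStaple e p U := by
  unfold plaqStaple
  split_ifs with h
  · exact (Word.split p.1 (boundaryWord p) e h).staple_update U g
  · rfl

/-- The staple of `p` at `e` does not read an edge `e'` that `p` does not read. [folklore] -/
theorem plaqStaple_update_of_not_mem (e : Edge d L) (p : Plaquette d L) (U : GaugeConfig d L G) {e' : Edge d L}
    (he' : e' ∉ Word.edgesRead p.1 (boundaryWord p)) (g : G) :
    plaqStaple e p (Function.update U e' g) = plaqStaple e p U := by
  unfold plaqStaple
  split_ifs with h
  · exact (Word.split p.1 (boundaryWord p) e h).staple_update_of_not_mem U he' g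
  · rfl

/-- The staple depends continuously on the configuration (`G : Type`, as in the tree's
`WordDerivative.continuous_wordHolonomy`). [folklore] -/
theorem continuous_plaqStaple {H : Type} [Group H] [TopologicalSpace H] [IsTopologicalGroup H] (e : Edge d L)
    (p : Plaquette d L) : Continuous fun U : GaugeConfig d L H => plaqStaple e p U := by
  unfold plaqStaple
  split_ifs with h
  · unfold Word.Split.staple Word.Split.preHol Word.Split.sufHol
    split_ifs
    · exact Continuous.mul (continuous_wordHolonomy _ _) (continuous_wordHolonomy _ _)
    · exact Continuous.inv (Continuous.mul (continuous_wordHolonomy _ _) (continuous_wordHolonomy _ _))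
  · exact continuous_const

variable [TopologicalSpace G] [IsTopologicalGroup G] {N : ℕ} [CompactSpace G] (ρ : G →* Matrix (Fin N) (Fin N) ℂ)
  [NeZero L]

/-- The part of the action not seen by the link `e`: plaquettes not reading `e` contribute `N - Re tr ρ(U_p)`,
plaquettes reading `e` contribute the constant `N`. [folklore] -/
def farAction (e : Edge d L) (U : GaugeConfig d L G) : ℝ :=
  ∑ p : Plaquette d L, if e ∈ Word.edgesRead p.1 (boundaryWord p) then (N : ℝ)
    else (N : ℝ) - (ρ (wordHolonomy U p.1 (boundaryWord p))).trace.re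

/-- **The Wilson action with the link `e` replaced by `g`** (`L ≥ 2`, continuous representation of a compact group):
`S(U[e ↦ g]) = farAction e U - ∑_{p reads e} Re tr ρ(g · plaqStaple e p U)`. [folklore] -/
theorem wilsonAction_update (hL : 1 < L) (hρ : Continuous ρ) (e : Edge d L) (U : GaugeConfig d L G) (g : G) :
    wilsonAction ρ (Function.update U e g) =
      farAction ρ e U - ∑ p ∈ plaqsReading e, (ρ (g * plaqStaple e p U)).trace.re := by
  classical
  unfold wilsonAction farAction plaqsReading
  rw [Finset.sum_filter, ← Finset.sum_sub_distrib]
  refine Finset.sum_congr rfl fun p _ => ?_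
  rw [plaquetteHolonomy_eq_wordHolonomy]
  by_cases hp : e ∈ Word.edgesRead p.1 (boundaryWord p)
  · have h1 := count_edgesRead_boundaryWord_eq_one hL hp
    rw [if_pos hp, if_pos hp, (Word.split p.1 (boundaryWord p) e h1).re_trace_wordHolonomy_update ρ hρ U g]
    unfold plaqStaple
    rw [dif_pos h1]
  · rw [if_neg hp, if_neg hp, wordHolonomy_update_of_not_mem U e g _ _ hp, sub_zero]

end General

/-! ## `SU(2)`: the quaternionic staple sum -/

section SU2

variable [NeZero L]

/-- `quatMatrix` as an additive monoid homomorphism `ℍ →+ M₂(ℂ)`. [folklore] -/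
def quatMatrixHom : Quaternion ℝ →+ Matrix (Fin 2) (Fin 2) ℂ where
  toFun := quatMatrix
  map_zero' := by
    ext i j
    fin_cases i <;> fin_cases j <;> apply Complex.ext <;> simp [quatMatrix] <;> rfl
  map_add' p q := by
    ext i j
    fin_cases i <;> fin_cases j <;> apply Complex.ext <;> simp [quatMatrix] <;> ring

/-- Unfolding lemma `quatMatrixHom_apply`. [folklore] -/
@[simp] theorem quatMatrixHom_apply (q : Quaternion ℝ) : quatMatrixHom q = quatMatrix q := rfl

/-- `quatMatrix` of a finite sum is the sum of the matrices. [folklore] -/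
theorem quatMatrix_sum {ι : Type*} (s : Finset ι) (f : ι → Quaternion ℝ) :
    quatMatrix (∑ i ∈ s, f i) = ∑ i ∈ s, quatMatrix (f i) := by
  rw [← quatMatrixHom_apply, map_sum]
  rfl

/-- `su2Quat` in the basis `1, i, j, k` of `ℍ`. [folklore] -/
theorem su2Quat_eq (W : SU 2) : su2Quat W =
    ((W.1 0 0).re : Quaternion ℝ) + ((W.1 0 0).im : Quaternion ℝ) * ⟨0, 1, 0, 0⟩ +
      ((W.1 0 1).re : Quaternion ℝ) * ⟨0, 0, 1, 0⟩ + ((W.1 0 1).im : Quaternion ℝ) * ⟨0, 0, 0, 1⟩ := by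
  ext <;> simp [su2Quat]

/-- `su2Quat : SU(2) → ℍ` is continuous. [folklore] -/
theorem continuous_su2Quat : Continuous (su2Quat : SU 2 → Quaternion ℝ) := by
  have h : (su2Quat : SU 2 → Quaternion ℝ) = fun W =>
      ((W.1 0 0).re : Quaternion ℝ) + ((W.1 0 0).im : Quaternion ℝ) * ⟨0, 1, 0, 0⟩ +
        ((W.1 0 1).re : Quaternion ℝ) * ⟨0, 0, 1, 0⟩ + ((W.1 0 1).im : Quaternion ℝ) * ⟨0, 0, 0, 1⟩ :=
    funext su2Quat_eq
  rw [h]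
  have hre : ∀ i j : Fin 2, Continuous fun W : SU 2 => (((W.1 i j).re : ℝ) : Quaternion ℝ) := fun i j =>
    Quaternion.continuous_coe.comp (Complex.continuous_re.comp (SU2OneLink.continuous_apply_entry i j))
  have him : ∀ i j : Fin 2, Continuous fun W : SU 2 => (((W.1 i j).im : ℝ) : Quaternion ℝ) := fun i j =>
    Quaternion.continuous_coe.comp (Complex.continuous_im.comp (SU2OneLink.continuous_apply_entry i j))
  exact (((hre 0 0).add ((him 0 0).mul continuous_const)).add ((hre 0 1).mul continuous_const)).add
    ((him 0 1).mul continuous_const)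

/-- **The quaternionic staple sum** `k_e(U) = ∑_{p reads e} su2Quat (plaqStaple e p U)` — Creutz's `K_e`, the sum of
the `2(d-1)` staples of the link `e`, as a quaternion (so that `K_e = ‖k_e‖ · V`, `V ∈ SU(2)`). [folklore] -/
def stapleSum (e : Edge d L) (U : GaugeConfig d L (SU 2)) : Quaternion ℝ :=
  ∑ p ∈ plaqsReading e, su2Quat (plaqStaple e p U)

/-- `∑_{p reads e} Re tr (g · plaqStaple e p U) = Re tr (g · quatMatrix (stapleSum e U))`. [folklore] -/
theorem sum_re_trace_eq_stapleSum (e : Edge d L) (U : GaugeConfig d L (SU 2)) (g : SU 2) :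
    ∑ p ∈ plaqsReading e, ((suRep 2) (g * plaqStaple e p U)).trace.re =
      (g.1 * quatMatrix (stapleSum e U)).trace.re := by
  unfold stapleSum
  rw [quatMatrix_sum, Finset.mul_sum, Matrix.trace_sum, Complex.re_sum]
  refine Finset.sum_congr rfl fun p _ => ?_
  rw [quatMatrix_su2Quat]
  rfl

/-- `‖k_e(U)‖ ≤ #{p reads e} ≤ 2(d-1)` (each staple is a unit quaternion). [folklore] -/
theorem norm_stapleSum_le (e : Edge d L) (U : GaugeConfig d L (SU 2)) :
    ‖stapleSum e U‖ ≤ ((2 * (d - 1) : ℕ) : ℝ) := by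
  have h1 : ‖stapleSum e U‖ ≤ (plaqsReading e).card := by
    unfold stapleSum
    refine (norm_sum_le _ _).trans ?_
    rw [Finset.card_eq_sum_ones, Nat.cast_sum]
    refine Finset.sum_le_sum fun p _ => ?_
    rw [norm_su2Quat, Nat.cast_one]
  exact h1.trans (by exact_mod_cast card_plaqsReading_le e)

/-- The staple sum does not read `e`. [folklore] -/
theorem stapleSum_update_self (e : Edge d L) (U : GaugeConfig d L (SU 2)) (g : SU 2) :
    stapleSum e (Function.update U e g) = stapleSum e U := by
  unfold stapleSum
  exact Finset.sum_congr rfl fun p _ => by rw [plaqStaple_update_self]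

/-- The staple sum of `e` does not read any edge `e'` sharing no plaquette with `e`. [folklore] -/
theorem stapleSum_update_of_not_share {e e' : Edge d L} (h : ¬ SharePlaquette e e') (U : GaugeConfig d L (SU 2))
    (g : SU 2) : stapleSum e (Function.update U e' g) = stapleSum e U := by
  unfold stapleSum
  refine Finset.sum_congr rfl fun p hp => ?_
  rw [mem_plaqsReading] at hp
  have he' : e' ∉ Word.edgesRead p.1 (boundaryWord p) := fun h' => h ⟨p, hp, h'⟩
  rw [plaqStaple_update_of_not_mem e p U he']

/-- The staple sum depends continuously on the configuration. [folklore] -/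
theorem continuous_stapleSum (e : Edge d L) : Continuous fun U : GaugeConfig d L (SU 2) => stapleSum e U := by
  unfold stapleSum
  exact continuous_finsetSum _ fun p _ => continuous_su2Quat.comp (continuous_plaqStaple e p)

/-- **Weight factorisation at one link** (`SU(2)`, fundamental representation, tree coupling `t`, `L ≥ 2`):
`exp(-t S(U[e ↦ g])) = exp(-t · farAction e U) · exp(t · Re tr(g · quatMatrix (stapleSum e U)))`. [folklore] -/
theorem exp_neg_mul_wilsonAction_update (hL : 1 < L) (t : ℝ) (e : Edge d L) (U : GaugeConfig d L (SU 2))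
    (g : SU 2) : Real.exp (-t * wilsonAction (suRep 2) (Function.update U e g)) =
      Real.exp (-t * farAction (suRep 2) e U) * Real.exp (t * (g.1 * quatMatrix (stapleSum e U)).trace.re) := by
  rw [wilsonAction_update (suRep 2) hL (continuous_suRep 2) e U g, ← sum_re_trace_eq_stapleSum, ← Real.exp_add]
  congr 1
  ring

end SU2

/-! ## Two more facts about the one-link mean -/

namespace SU2OneLink

/-- `|linkMean B| ≤ 1` (`|½ Re tr W| ≤ 1`). [folklore] -/
theorem abs_linkMean_le_one (B : ℝ) : |linkMean B| ≤ 1 := by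
  have hZ := linkZ_pos B
  have htr : ∀ W : SU 2, |1 / 2 * (W.1.trace).re| ≤ 1 := by
    intro W
    have h := Literature.RepresentationTheory.CompactGroups.CompactGroup.abs_re_trace_le_card (suRep 2)
      (continuous_suRep 2) W
    rw [Fintype.card_fin] at h
    rw [abs_mul, abs_of_pos (by norm_num : (0 : ℝ) < 1 / 2)]
    have h' : |(W.1.trace).re| ≤ 2 := by simpa using h
    linarith
  have hcont : Continuous fun W : SU 2 => Real.exp (B * (W.1.trace).re) :=
    Real.continuous_exp.comp (continuous_const.mul continuous_trace_re)
  have hN : |linkN B| ≤ linkZ B := by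
    unfold linkN linkZ
    refine (abs_integral_le_integral_abs).trans (integral_mono ?_ (integrable_of_continuous hcont) fun W => ?_)
    · exact (integrable_of_continuous ((continuous_const.mul continuous_trace_re).mul hcont)).abs
    · simp only [abs_mul, Real.abs_exp]
      calc |1 / 2| * |(W.1.trace).re| * Real.exp (B * (W.1.trace).re)
          = |1 / 2 * (W.1.trace).re| * Real.exp (B * (W.1.trace).re) := by rw [abs_mul]
        _ ≤ 1 * Real.exp (B * (W.1.trace).re) :=
          mul_le_mul_of_nonneg_right (htr W) (Real.exp_nonneg _)
        _ = _ := one_mul _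
  unfold linkMean
  rw [abs_div, abs_of_pos hZ, div_le_one hZ]
  exact hN

/-- `linkZ B = I₀(2B) - I₂(2B)` (tree). [folklore] -/
theorem linkZ_eq_besselI (B : ℝ) : linkZ B = besselI 0 (2 * B) - besselI 2 (2 * B) :=
  SU2OneLink.integral_exp_mul_re_trace_eq_besselI_sub B

/-- `linkN B = ½ (I₁(2B) - I₃(2B))` (tree). [folklore] -/
theorem linkN_eq_besselI (B : ℝ) : linkN B = 1 / 2 * (besselI 1 (2 * B) - besselI 3 (2 * B)) := by
  rw [← SU2OneLink.integral_re_trace_mul_exp_eq_besselI_sub B]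
  unfold linkN
  rw [← integral_const_mul]
  refine integral_congr_ae (Filter.Eventually.of_forall fun W => ?_)
  ring

/-- The one-link mean is a continuous function of the effective coupling. [folklore] -/
theorem continuous_linkMean : Continuous linkMean := by
  have h : linkMean = fun B => (1 / 2 * (besselI 1 (2 * B) - besselI 3 (2 * B))) /
      (besselI 0 (2 * B) - besselI 2 (2 * B)) := by
    funext B; rw [linkMean, linkN_eq_besselI, linkZ_eq_besselI]
  rw [h]
  have hc : ∀ n : ℕ, Continuous fun B : ℝ => besselI n (2 * B) := fun n =>
    (differentiable_besselI n).continuous.comp (continuous_const.mul continuous_id)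
  refine (continuous_const.mul ((hc 1).sub (hc 3))).div ((hc 0).sub (hc 2)) fun B => ?_
  rw [← linkZ_eq_besselI]
  exact (linkZ_pos B).ne'

end SU2OneLink

end Summit.QuantumFields.GaugeBoot

end
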